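import Summits.ResolutionOfSingularities.ResolutionOfSingularities.Theorems.WeightedInvariantWeightedConstructionACEquivalence

/-!
# [OURS · L1 W4.3] definitions of the door line pointwise-lexmax-hull of crux WeightedConstruction stmt-ResolutionOfSingularities-0571 — our construction programme, NOT a statement of the manuscript

Route `ResolutionOfSingularities/WeightedInvariant`, crux `WeightedConstruction`
(stmt-ResolutionOfSingularities-0571, `∀ p prime, Nonempty (WeightedResolutionDatum p)`), line
`pointwise-lexmax-hull` (registered skeleton `Cruxes/WeightedConstruction/Lines/pointwise_lexmax_hull.lean`,
planner-cstrat 2026-08-17; plan of record CHAIN w43 v0.5, 2026-08-26). This file carries VERBATIM the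
sorry-free definitions of the skeleton — `Profile`, `chartProfile`, `XSing`, `AdmissibleProfileAt`,
`AdmissibleProfileOnAt`, the structure `LexmaxHullRule p` (the line's named inhabitant: pointwise
maximal admissible profile `plex`, its generic value `gen`, the usc hull `hull`, the support-first /
weights-second `centre`, the degree `deg`, pinned by their defining properties) and the stub predicates
`LexmaxHullRule.{USC, HullComap, HullBaseChange, CentreRegular, HullDrop}` — with the SAME short names, in
the sub-namespace `…Theorems.PointwiseLexmaxHull`, so that the skeleton (v2) `open`s this namespace and
every registered stub signature keeps its text. It adds the three `plex`-level properties
`LexmaxHullRule.{PlexStrata, PlexComap, PlexBaseChange}` into which stub `stub_hullUsc` is split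
(res-L1-w43-stub-2, evidence #44 on the crux item; reductions in `Theorems/…HullUscToolkit.lean` p459633,
`…HullUscGenericValue.lean` p460524, `…HullUscTight.lean`). No theorem is claimed here; the skeleton's
module docstring (THE NAMED INHABITANT, calibration, dead lines avoided) is not repeated.
Cite keys of the skeleton's docstrings normalised (`arXiv:2507.01232` = `AbramovichQuekSchober2025`).
-/

noncomputable section

open CategoryTheory CategoryTheory.Limits AlgebraicGeometry TopologicalSpace
open Literature.AlgebraicGeometry.Resolution
open Summit.ResolutionOfSingularities.ResolutionOfSingularities.Theses.WeightedInvariant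

set_option linter.dupNamespace false -- mandated namespace of this single-conjunct summit

namespace Summit.ResolutionOfSingularities.ResolutionOfSingularities.Theorems.PointwiseLexmaxHull

/-! ## Profiles: sorted weight-inverses, `∞`-padded, compared lexicographically -/

/-- **Profiles.** A profile is an eventually-`⊤` sequence of rationals read lexicographically:
`(a₁, a₂, …, a_k, ⊤, ⊤, …)`; the `⊤`-padding realises the ATW/AQS convention that a TRUNCATED sequence
is LARGER (`(2,3) = (2,3,⊤) > (2,3,5)`), which is also what makes the lexmax exclude free smooth
directions (a direction of weight `0` contributes `⊤`). NOT well-founded as a type — see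
`stub_recoding`. [cite: AbramovichTemkinWlodarczyk2024, §5; AbramovichQuekSchober2025, Def. 3.2] -/
abbrev Profile : Type := Lex (ℕ → WithTop ℚ)

/-- The profile of a weighted chart with weights `w` (listed so that `d / wᵢ` is non-decreasing,
i.e. `w` antitone) normalised in degree `d`: `n ↦ d / wₙ` for `n < m`, `⊤` beyond. [folklore] -/
def chartProfile {m : ℕ} (d : ℕ) (w : Fin m → ℕ) : Profile :=
  toLex fun n => if h : n < m then (((d : ℚ) / (w ⟨n, h⟩ : ℚ) : ℚ) : WithTop ℚ) else ⊤

/-- `X` is SINGULAR (present and non-regular) at the point `y` of `Y`: the negation of the right-hand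
side of axiom `(ii)`. [folklore] -/
def XSing {Y : Scheme.{0}} (X : Y.IdealSheafData) (y : Y) : Prop :=
  ∃ x : X.subscheme, X.subschemeι x = y ∧ ¬ IsRegularLocalRing (X.subscheme.presheaf.stalk x)

/-- **Admissible profile at a point.** `π` is the profile of a regular weighted chart ADMISSIBLE for
`X` at `y`: an affine open `U ∋ y`, sections `u₁,…,uₘ ∈ Γ(Y,U)` vanishing at `y` whose cotangent
classes at `y` are linearly independent (part of a regular system of parameters AT `y`), positive
antitone weights `w` and a degree `d > 0` with `X|_U ⊆ (u^α : Σ wᵢαᵢ ≥ d)` — the monomial valuation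
`v(uᵢ) = wᵢ/d` has `v(X) ≥ 1` (AQS Def. 3.3 "admissible", ATW §5) — and `π = (d/w₁ ≤ … ≤ d/wₘ, ⊤, …)`.
[cite: AbramovichQuekSchober2025, Def. 3.3; AbramovichTemkinWlodarczyk2024, §5] -/
def AdmissibleProfileAt {Y : Scheme.{0}} (X : Y.IdealSheafData) (y : Y) (π : Profile) : Prop :=
  ∃ (U : Y.affineOpens) (hy : y ∈ (U : Y.Opens)) (m : ℕ) (u : Fin m → Γ(Y, U)) (w : Fin m → ℕ) (d : ℕ),
    (∀ i, 0 < w i) ∧ Antitone w ∧ 0 < d ∧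
    (∃ h : ∀ i, (Y.presheaf.germ (U : Y.Opens) y hy).hom (u i) ∈
        IsLocalRing.maximalIdeal (Y.presheaf.stalk y),
      LinearIndependent (IsLocalRing.ResidueField (Y.presheaf.stalk y))
        (fun i => (IsLocalRing.maximalIdeal (Y.presheaf.stalk y)).toCotangent ⟨_, h i⟩)) ∧
    X.ideal U ≤ weightedMonomialIdeal u w d ∧
    π = chartProfile d w

/-- **Admissible profile at a point, with prescribed support.** As `AdmissibleProfileAt`, and the chart
is SUPPORTED EXACTLY ON the closed set `Z` over `U`: `V(u) ∩ U = Z ∩ U` (so, when `Z` is the maximum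
locus, the chart presents a centre supported exactly on it — the "support first" constraint that excludes
Frobenius-twisted point-supported centres along a stratum). [folklore] -/
def AdmissibleProfileOnAt {Y : Scheme.{0}} (X : Y.IdealSheafData) (Z : Set Y) (y : Y) (π : Profile) :
    Prop :=
  ∃ (U : Y.affineOpens) (hy : y ∈ (U : Y.Opens)) (m : ℕ) (u : Fin m → Γ(Y, U)) (w : Fin m → ℕ) (d : ℕ),
    (∀ i, 0 < w i) ∧ Antitone w ∧ 0 < d ∧
    (∃ h : ∀ i, (Y.presheaf.germ (U : Y.Opens) y hy).hom (u i) ∈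
        IsLocalRing.maximalIdeal (Y.presheaf.stalk y),
      LinearIndependent (IsLocalRing.ResidueField (Y.presheaf.stalk y))
        (fun i => (IsLocalRing.maximalIdeal (Y.presheaf.stalk y)).toCotangent ⟨_, h i⟩)) ∧
    X.ideal U ≤ weightedMonomialIdeal u w d ∧
    (∀ y' : Y, y' ∈ (U : Y.Opens) → (y' ∈ Z ↔ ∀ i, y' ∉ Y.basicOpen (u i))) ∧
    π = chartProfile d w

/-! ## The rule -/

/-- **The pointwise-lexmax-hull rule in characteristic `p`** (the line's named inhabitant, as a
structure of its OUTPUTS pinned by their defining properties; existence = `stub_ruleExists`).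
For every field `k`, `k`-scheme `f : Y → Spec k` and ideal sheaf `X` on `Y` (total data, meaningful for
`k` perfect of characteristic `p`, `f` smooth separated quasi-compact, at SINGULAR points of `X`):
`plex` = maximal admissible profile at closed points; `gen η` = generic closed-point value of `plex` on
`closure {η}`; `hull y` = maximum of `gen` over singular generisations of `y`; `centre` = a regular
weighted-chart presentation, lex-maximal among centres supported exactly on the maximum locus of `hull`
and admissible for `X` in degree `deg`. [cite: AbramovichTemkinWlodarczyk2024, §5 and Thm 1.1.1;
AbramovichQuekSchober2025, Def. 3.3, Thm 3.5, Thm 1.1] -/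
structure LexmaxHullRule (p : ℕ) : Type 1 where
  /-- pointwise maximal admissible profile (meaningful at closed singular points) -/
  plex : ∀ ⦃k : Type⦄ [Field k] ⦃Y : Scheme.{0}⦄, (Y ⟶ Spec (.of k)) → Y.IdealSheafData → Y → Profile
  /-- generic closed-point value of `plex` on the closure of a point -/
  gen : ∀ ⦃k : Type⦄ [Field k] ⦃Y : Scheme.{0}⦄, (Y ⟶ Spec (.of k)) → Y.IdealSheafData → Y → Profile
  /-- the usc hull: max of `gen` over singular generisations (the rating `inv` on singular points) -/
  hull : ∀ ⦃k : Type⦄ [Field k] ⦃Y : Scheme.{0}⦄, (Y ⟶ Spec (.of k)) → Y.IdealSheafData → Y → Profile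
  /-- the weighted centre -/
  centre : ∀ ⦃k : Type⦄ [Field k] ⦃Y : Scheme.{0}⦄, (Y ⟶ Spec (.of k)) → Y.IdealSheafData →
    ReesAlgebraData Y
  /-- the degree in which `X` is admissible for the centre -/
  deg : ∀ ⦃k : Type⦄ [Field k] ⦃Y : Scheme.{0}⦄, (Y ⟶ Spec (.of k)) → Y.IdealSheafData → ℕ
  /-- (R2) at a CLOSED singular point, `plex` is the greatest admissible profile -/
  plex_isGreatest : ∀ ⦃k : Type⦄ [Field k] [CharP k p] [PerfectField k] ⦃Y : Scheme.{0}⦄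
    (f : Y ⟶ Spec (.of k)) [Smooth f] [IsSeparated f] [QuasiCompact f] (X : Y.IdealSheafData)
    (y : Y), IsClosed ({y} : Set Y) → XSing X y →
    IsGreatest {π | AdmissibleProfileAt X y π} (plex f X y)
  /-- (Rg) `gen η` is the value of `plex` at the closed points of a dense open part of `closure {η}` -/
  gen_spec : ∀ ⦃k : Type⦄ [Field k] [CharP k p] [PerfectField k] ⦃Y : Scheme.{0}⦄
    (f : Y ⟶ Spec (.of k)) [Smooth f] [IsSeparated f] [QuasiCompact f] (X : Y.IdealSheafData)
    (η : Y), XSing X η →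
    ∃ W : Y.Opens, η ∈ W ∧ ∀ y : Y, y ∈ W → η ⤳ y → IsClosed ({y} : Set Y) → plex f X y = gen f X η
  /-- (R1) `hull y` is the greatest `gen η` over the singular generisations `η ⤳ y` -/
  hull_isGreatest : ∀ ⦃k : Type⦄ [Field k] [CharP k p] [PerfectField k] ⦃Y : Scheme.{0}⦄
    (f : Y ⟶ Spec (.of k)) [Smooth f] [IsSeparated f] [QuasiCompact f] (X : Y.IdealSheafData)
    (y : Y), XSing X y →
    IsGreatest {π | ∃ η : Y, η ⤳ y ∧ XSing X η ∧ π = gen f X η} (hull f X y)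
  /-- (Rc1) support FIRST: the centre is supported exactly on the maximum locus of `hull` among the
  singular points (guard: some singular point) -/
  support_centre : ∀ ⦃k : Type⦄ [Field k] [CharP k p] [PerfectField k] ⦃Y : Scheme.{0}⦄
    (f : Y ⟶ Spec (.of k)) [Smooth f] [IsSeparated f] [QuasiCompact f] (X : Y.IdealSheafData),
    (∃ y : Y, XSing X y) →
    (centre f X).support = {y : Y | XSing X y ∧ ∀ y' : Y, XSing X y' → hull f X y' ≤ hull f X y}
  /-- (Rc2) the centre is admissible for `X` in degree `deg` -/
  le_piece : ∀ ⦃k : Type⦄ [Field k] [CharP k p] [PerfectField k] ⦃Y : Scheme.{0}⦄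
    (f : Y ⟶ Spec (.of k)) [Smooth f] [IsSeparated f] [QuasiCompact f] (X : Y.IdealSheafData),
    (∃ y : Y, XSing X y) → X ≤ (centre f X).piece (deg f X)
  /-- (Rc3) weights SECOND: at every point of its support the centre has a chart whose profile
  dominates every admissible profile of a chart supported exactly on the maximum locus -/
  centre_max : ∀ ⦃k : Type⦄ [Field k] [CharP k p] [PerfectField k] ⦃Y : Scheme.{0}⦄
    (f : Y ⟶ Spec (.of k)) [Smooth f] [IsSeparated f] [QuasiCompact f] (X : Y.IdealSheafData),
    (∃ y : Y, XSing X y) → ∀ (y : Y), y ∈ (centre f X).support →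
    ∀ π : Profile, AdmissibleProfileOnAt X (centre f X).support y π →
      ∃ (U : Y.affineOpens) (_ : y ∈ (U : Y.Opens)) (m : ℕ) (u : Fin m → Γ(Y, U)) (w : Fin m → ℕ),
        (centre f X).IsWeightedChart U u w ∧ Antitone w ∧ π ≤ chartProfile (deg f X) w

namespace LexmaxHullRule

variable {p : ℕ} (R : LexmaxHullRule p)

/-- `(usc)` for the rule: superlevel sets of `hull` inside the singular locus are closed. -/
def USC : Prop :=
  ∀ ⦃k : Type⦄ [Field k] [CharP k p] [PerfectField k] ⦃Y : Scheme.{0}⦄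
    (f : Y ⟶ Spec (.of k)) [Smooth f] [IsSeparated f] [QuasiCompact f] (X : Y.IdealSheafData)
    (γ : Profile), IsClosed {y : Y | XSing X y ∧ γ ≤ R.hull f X y}

/-- `(i)` for `hull`, smooth `k`-morphisms (at singular points). -/
def HullComap : Prop :=
  ∀ ⦃k : Type⦄ [Field k] [CharP k p] [PerfectField k] ⦃Y Y₁ : Scheme.{0}⦄
    (f : Y ⟶ Spec (.of k)) [Smooth f] [IsSeparated f] [QuasiCompact f]
    (f₁ : Y₁ ⟶ Spec (.of k)) [Smooth f₁] [IsSeparated f₁] [QuasiCompact f₁]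
    (g : Y₁ ⟶ Y) [Smooth g], g ≫ f = f₁ →
    ∀ (X : Y.IdealSheafData) (y₁ : Y₁), XSing X (g y₁) → R.hull f₁ (X.comap g) y₁ = R.hull f X (g y₁)

/-- `(i)` for `hull`, perfect ground-field extensions (at singular points). -/
def HullBaseChange : Prop :=
  ∀ ⦃k : Type⦄ [Field k] [CharP k p] [PerfectField k]
    ⦃K : Type⦄ [Field K] [PerfectField K] (φ : k →+* K)
    ⦃Y YK : Scheme.{0}⦄ (f : Y ⟶ Spec (.of k)) [Smooth f] [IsSeparated f] [QuasiCompact f]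
    (fK : YK ⟶ Spec (.of K)) (pr : YK ⟶ Y),
    IsPullback pr fK f (Spec.map (CommRingCat.ofHom φ)) →
    ∀ (X : Y.IdealSheafData) (y : YK), XSing X (pr y) → R.hull fK (X.comap pr) y = R.hull f X (pr y)

/-- `(iii)` for the rule: regular weighted centre, functorial for smooth surjections and perfect base
change. -/
def CentreRegular : Prop :=
  (∀ ⦃k : Type⦄ [Field k] [CharP k p] [PerfectField k] ⦃Y : Scheme.{0}⦄
    (f : Y ⟶ Spec (.of k)) [Smooth f] [IsSeparated f] [QuasiCompact f] (X : Y.IdealSheafData),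
    (∃ y : Y, XSing X y) → (R.centre f X).IsRegularWeightedCentre) ∧
  (∀ ⦃k : Type⦄ [Field k] [CharP k p] [PerfectField k] ⦃Y Y₁ : Scheme.{0}⦄
    (f : Y ⟶ Spec (.of k)) [Smooth f] [IsSeparated f] [QuasiCompact f]
    (f₁ : Y₁ ⟶ Spec (.of k)) [Smooth f₁] [IsSeparated f₁] [QuasiCompact f₁]
    (g : Y₁ ⟶ Y) [Smooth g] [Surjective g], g ≫ f = f₁ →
    ∀ (X : Y.IdealSheafData), (∃ y : Y, XSing X y) →
    ∀ n : ℕ, (R.centre f₁ (X.comap g)).piece n = ((R.centre f X).piece n).comap g) ∧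
  (∀ ⦃k : Type⦄ [Field k] [CharP k p] [PerfectField k]
    ⦃K : Type⦄ [Field K] [PerfectField K] (φ : k →+* K)
    ⦃Y YK : Scheme.{0}⦄ (f : Y ⟶ Spec (.of k)) [Smooth f] [IsSeparated f] [QuasiCompact f]
    (fK : YK ⟶ Spec (.of K)) (pr : YK ⟶ Y),
    IsPullback pr fK f (Spec.map (CommRingCat.ofHom φ)) →
    ∀ (X : Y.IdealSheafData), (∃ y : Y, XSing X y) →
    ∀ n : ℕ, (R.centre fK (X.comap pr)).piece n = ((R.centre f X).piece n).comap pr)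

/-- `(iv)` for the rule, in the landed ACChart form (Theorems/…ACReduction.lean): over an ALGEBRAICALLY
CLOSED ground field, on an affine open carrying a weighted chart of the centre, with `B₊(U) → Spec k`
smooth separated quasi-compact, at a CLOSED point `b` of the exceptional divisor at which the strict
transform is SINGULAR, the hull of the successor pair is strictly `∞`-lex below the maximum of `hull`
on the singular points of `(Y, X)`. -/
def HullDrop : Prop :=
  ∀ ⦃k : Type⦄ [Field k] [CharP k p] [PerfectField k] [IsAlgClosed k]
    ⦃Y : Scheme.{0}⦄ (f : Y ⟶ Spec (.of k)) [Smooth f] [IsSeparated f] [QuasiCompact f]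
    (X : Y.IdealSheafData), (∃ y : Y, XSing X y) →
    ∀ (U : Y.affineOpens),
      (∃ (m : ℕ) (u : Fin m → Γ(Y, U)) (w : Fin m → ℕ), (R.centre f X).IsWeightedChart U u w) →
      Smooth ((R.centre f X).cobordantPlusι U ≫ f) →
      IsSeparated ((R.centre f X).cobordantPlusι U ≫ f) →
      QuasiCompact ((R.centre f X).cobordantPlusι U ≫ f) →
      ∀ (b : (R.centre f X).cobordantPlus U), IsClosed ({b} : Set ((R.centre f X).cobordantPlus U)) →
        (affineCobordantBlowup.plusOpens ((R.centre f X).chartIdeals U)).ι b ∈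
          ((affineCobordantBlowup.exceptional ((R.centre f X).chartIdeals U)).support :
            Set (affineCobordantBlowup ((R.centre f X).chartIdeals U))) →
        XSing ((R.centre f X).cobordantStrictTransform U X) b →
        ∀ y : Y, XSing X y → (∀ y' : Y, XSing X y' → R.hull f X y' ≤ R.hull f X y) →
          R.hull ((R.centre f X).cobordantPlusι U ≫ f) ((R.centre f X).cobordantStrictTransform U X) b
            < R.hull f X y

/-! ## Residual `plex`-level properties (split of stub `stub_hullUsc`, res-L1-w43-stub-2, plan of record CHAIN v0.5) -/

/-- **(B1') `PlexStrata`** — constructibility of the pointwise invariant on the singular locus: finitely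
many singular points `η₀ ∈ F` with open neighbourhoods `W η₀` such that the strata `W η₀ ∩ closure {η₀}`
cover the singular locus and `plex` has the constant value `gen η₀` at the CLOSED points of the stratum
of `η₀` (equivalently — `Theorems.genericValue_eq_gen_of_const` — is constant there). With
`Theorems.isClosed_superlevel_genHull_xSing_of_plexStrata` it gives `(usc)`. (OURS.) -/
def PlexStrata : Prop :=
  ∀ ⦃k : Type⦄ [Field k] [CharP k p] [PerfectField k] ⦃Y : Scheme.{0}⦄
    (f : Y ⟶ Spec (.of k)) [Smooth f] [IsSeparated f] [QuasiCompact f] (X : Y.IdealSheafData),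
    ∃ (F : Set Y) (W : Y → Y.Opens), F.Finite ∧ (∀ η₀ ∈ F, XSing X η₀) ∧
      (∀ η : Y, XSing X η → ∃ η₀ ∈ F, η₀ ⤳ η ∧ η ∈ W η₀) ∧
      (∀ η₀ ∈ F, ∀ y : Y, y ∈ W η₀ → η₀ ⤳ y → IsClosed ({y} : Set Y) →
        R.plex f X y = R.gen f X η₀)

/-- **(B2') `PlexComap`** — invariance of the pointwise invariant at CLOSED singular points under smooth
`k`-morphisms (functoriality of the maximal admissible profile for smooth morphisms, the analogue of
ATW Thm 1.1.1 functoriality; only the GREATEST admissible profiles agree, the admissible sets differ).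
With `Theorems.genHull_comap_eq_of_smooth_of_plex` it gives `(i)` for smooth morphisms. (OURS; the
char-0 model is the functoriality clause of Abramovich–Temkin–Włodarczyk 2024, Thm 1.1.1.) -/
def PlexComap : Prop :=
  ∀ ⦃k : Type⦄ [Field k] [CharP k p] [PerfectField k] ⦃Y Y₁ : Scheme.{0}⦄
    (f : Y ⟶ Spec (.of k)) [Smooth f] [IsSeparated f] [QuasiCompact f]
    (f₁ : Y₁ ⟶ Spec (.of k)) [Smooth f₁] [IsSeparated f₁] [QuasiCompact f₁]
    (g : Y₁ ⟶ Y) [Smooth g], g ≫ f = f₁ →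
    ∀ (X : Y.IdealSheafData) (y₁ : Y₁), IsClosed ({y₁} : Set Y₁) → XSing X (g y₁) →
      R.plex f₁ (X.comap g) y₁ = R.plex f X (g y₁)

/-- **(B3') `PlexBaseChange`** — for a perfect ground-field extension `pr : Y ×_k K → Y`: at a CLOSED
singular point `y` of `Y ×_k K` the pointwise invariant equals the GENERIC value at the (possibly
non-closed) point `pr y` of `Y` (stability of the maximal admissible profile under extensions of perfect
fields, in generic form — `pr` need not preserve closed points). With
`Theorems.genHull_comap_eq_of_isPullback_of_plex` it gives `(i)` for perfect base change. (OURS; the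
dimension-2 model is the separable-stability clause of Abramovich–Quek–Schober 2025, Thm 3.5.) -/
def PlexBaseChange : Prop :=
  ∀ ⦃k : Type⦄ [Field k] [CharP k p] [PerfectField k]
    ⦃K : Type⦄ [Field K] [PerfectField K] (φ : k →+* K)
    ⦃Y YK : Scheme.{0}⦄ (f : Y ⟶ Spec (.of k)) [Smooth f] [IsSeparated f] [QuasiCompact f]
    (fK : YK ⟶ Spec (.of K)) (pr : YK ⟶ Y),
    IsPullback pr fK f (Spec.map (CommRingCat.ofHom φ)) →
    ∀ (X : Y.IdealSheafData) (y : YK), IsClosed ({y} : Set YK) → XSing X (pr y) →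
      R.plex fK (X.comap pr) y = R.gen f X (pr y)

end LexmaxHullRule

end Summit.ResolutionOfSingularities.ResolutionOfSingularities.Theorems.PointwiseLexmaxHull

end
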